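import Summits.HubbardSuperconductivity.HubbardLadder.R3R4Props
import Summits.HubbardSuperconductivity.HubbardSuperconductivity.Theorems.WeakCouplingBCSWcbcsSsbToTorusLROMomentClosure
import Literature.MathematicalPhysics.QuantumLattice.HubbardSzSectorLadder
import Literature.MathematicalPhysics.QuantumLattice.FinDimSpectrumSectorGibbsLimit
import Literature.MathematicalPhysics.QuantumLattice.PairFieldMomentum
import HarnessLib

/-!
# Rung R4⁻, energy-only route — the FINITE-VOLUME CERTIFICATE FORM of the pair-gap tower
inequality (any Hermitian `H`): what an energy-only ceiling row would have to certify

HONEST FRAMING (page 1): ladder R1–R4 with certified numbers; no claim on H/H₀. This file proves one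
inequality and its division by `L⁴`; it consumes five certified real inputs that NOBODY HOLDS for the
Hubbard model at any side (no certificate of this kind exists in the cell, none is requested by this
file), and the orders of magnitude below say the resulting row is WEAK at every certifiable side.
Companion of `PairGapCeiling.lean` (the thermodynamic-limit edges; same filing request).

The inequality (Tasaki–Watanabe's (13)–(15) on the torus Fock space, own-bottom form). For ANY
Hermitian `H` on `Fock (Orb (FermionTorus 2 L))` — the `t–t'` Hubbard model `hubbardTorusTT'`
included — any eigenvector `Hψ = Eψ` in the joint sector `szSector N 0`, `N ≥ 2`, and
`Δ = pairField dWaveFormFactor L`: given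
* FLOORS `l₋ ≤ E_H(N-2)`, `l₊ ≤ E_H(N+2)` on the neighbouring sector minima
  (`E_H(k) = minEnergyOn H (szSector k 0)`; lower-bound certificates, e.g. SDP / Anderson type),
* a CEILING `u ≥ E` (for a sector ground state: any variational upper bound on `E_H(N)`),
* `D ≥ Re⟨ψ, (Δ†[H,Δ] - [H,Δ]Δ†) ψ⟩` (a degree-≤ 6 fermionic polynomial for the Hubbard `H`: an
  observable row of a sector certificate) and `K ≥ |Re⟨ψ, ΔΔ†ψ⟩ - Re⟨ψ, Δ†Δψ⟩|` (degree ≤ 4),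
then `(l₋ + l₊ - 2u) · Re⟨ψ, Δ†Δ ψ⟩ ≤ D + |l₊ - u| · K` (`pairTower_of_certified_inputs`), and for a
normalised `ψ` with certified gap `g = l₋ + l₊ - 2u > 0`: `p_d(L; ψ) ≤ (D + |l₊ - u| K)/(g L⁴)`
(`pairFieldDensity_le_of_certified_inputs`; `p_d = pairFieldDensity`, the R4 order parameter).
Only `E ≤ u` is used (not a floor on `E`), because `‖Δψ‖², ‖Δ†ψ‖² ≥ 0`.

ORDERS OF MAGNITUDE (estimates, NOT certified): at `U = 8`, `D + |l₊ - u| K ≈ (30–60) · L²`, so the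
row reads `p_d ≲ (30–60)/(g L²)`: below Yang's kinematic `63/32` once `g L² ≳ 30`, below the
`t' = -0.25` side's expected `p_d ~ 10⁻²` only for `g L² ≳ 3000–6000`; and a certified `g > 0` asks
for three sector ground energies bracketed to absolute width `≲ 0.1 t` (`≈ 0.2 %` of `|E₀|` at
`L = 8`) — beyond the cell's engines except exact diagonalisation at `L = 4`. Recorded as a DESIGN
row type in `pub-hubbard-r3/R3-DESIGN.md` §18; not requested from the engines.

Tree inputs (reused by name, nothing restated): the own-bottom identity
`WcbcsSsbToTorusLRO.mc_dotProduct_doubleComm_of_eigen`, the sector maps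
`WcbcsSsbToTorusLRO.pairFieldAt_mulVec_mem_szSector` / `conjTranspose_pairFieldAt_mulVec_mem_szSector`
(momentum `0`, `pairFieldAt_zero`), the homogeneous variational principle
`mul_norm_le_of_unit_bound_submodule` with `minEnergyOn_le_rayleigh_of_mem`, and the Gram identity
`star_mulVec_dotProduct_mulVec`.

Sources: H. Tasaki, H. Watanabe, Phys. Rev. B 104 (2021) L180501, arXiv:2105.10692, eqs. (13)–(15)
and Theorem (10); T. Koma, H. Tasaki, J. Stat. Phys. 76 (1994) 745, Theorem 2.2; L. Pitaevskii,
S. Stringari, J. Low Temp. Phys. 85 (1991) 377 (the double-commutator inequality).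
-/

noncomputable section

namespace Summit.HubbardSuperconductivity.HubbardLadder

open Matrix Finset Filter Literature.Probability.LatticeModels
open Literature.MathematicalPhysics.QuantumLattice
open Summit.HubbardSuperconductivity.HubbardSuperconductivity.Theorems.WcbcsSsbToTorusLRO
  (mc_dotProduct_doubleComm_of_eigen pairFieldAt_mulVec_mem_szSector
    conjTranspose_pairFieldAt_mulVec_mem_szSector)
open scoped ComplexOrder

/-! ## The tower inequality with certified inputs -/

/-- Real bookkeeping with a certified energy CEILING in place of the eigenvalue: from
`dc = (a₋ - E S₋) + (a₊ - E S₊)`, `E ≤ u`, `S₋, S₊ ≥ 0`, the variational bounds `l₋ S₋ ≤ a₋`,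
`l₊ S₊ ≤ a₊`, `dc ≤ D` and `|S₊ - S₋| ≤ K`: `(l₋ + l₊ - 2u) S₋ ≤ D + |l₊ - u| K`. [folklore] -/
theorem pairTower_real {am ap E u lm lp Sm Sp dc D K : ℝ}
    (hre : dc = (am - E * Sm) + (ap - E * Sp)) (hD : dc ≤ D) (hu : E ≤ u) (hSm : 0 ≤ Sm)
    (hSp : 0 ≤ Sp) (hK : |Sp - Sm| ≤ K) (ham : lm * Sm ≤ am) (hap : lp * Sp ≤ ap) :
    (lm + lp - 2 * u) * Sm ≤ D + |lp - u| * K := by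
  have h1 : (lm - u) * Sm + (lp - u) * Sp ≤ D := by
    have e1 : (lm - u) * Sm ≤ am - E * Sm := by nlinarith
    have e2 : (lp - u) * Sp ≤ ap - E * Sp := by nlinarith
    linarith
  have hx : -((lp - u) * (Sp - Sm)) ≤ |lp - u| * K :=
    calc -((lp - u) * (Sp - Sm)) ≤ |(lp - u) * (Sp - Sm)| := neg_le_abs _
      _ = |lp - u| * |Sp - Sm| := abs_mul _ _
      _ ≤ |lp - u| * K := mul_le_mul_of_nonneg_left hK (abs_nonneg _)
  have hid : (lm + lp - 2 * u) * Sm =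
      ((lm - u) * Sm + (lp - u) * Sp) + -((lp - u) * (Sp - Sm)) := by ring
  rw [hid]
  linarith

/-- **TOWER INEQUALITY WITH CERTIFIED INPUTS** (Tasaki–Watanabe's (15) on the torus Fock space, for
ANY Hermitian `H` — the `t–t'` model included — and any eigenvector `Hψ = Eψ` in `szSector N 0`,
`N ≥ 2`; `Δ = pairField dWaveFormFactor L`). Inputs: sector-energy FLOORS `l₋ ≤ E_H(N-2)`,
`l₊ ≤ E_H(N+2)` (`E_H(k) = minEnergyOn H (szSector k 0)`), a CEILING `u ≥ E`, an upper bound `D` on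
`Re⟨ψ, (Δ†[H,Δ] - [H,Δ]Δ†) ψ⟩` and a bound `K ≥ |Re⟨ψ, ΔΔ†ψ⟩ - Re⟨ψ, Δ†Δψ⟩|`. Output:
`(l₋ + l₊ - 2u) · Re⟨ψ, Δ†Δ ψ⟩ ≤ D + |l₊ - u| · K`. The own-bottom identity is the tree's
`WcbcsSsbToTorusLRO.mc_dotProduct_doubleComm_of_eigen`; the sector bookkeeping
`Δψ ∈ szSector (N-2) 0`, `Δ†ψ ∈ szSector (N+2) 0` is the tree's
`WcbcsSsbToTorusLRO.pairFieldAt_mulVec_mem_szSector` (and its adjoint) at momentum `0`.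
[cite: TasakiWatanabe2021, eqs. (13)–(15)] -/
theorem pairTower_of_certified_inputs {L : ℕ} [NeZero L]
    {H : Matrix (Finset (Orb (FermionTorus 2 L))) (Finset (Orb (FermionTorus 2 L))) ℂ}
    (hH : H.IsHermitian) {N : ℕ} (hN : 2 ≤ N) {ψ : Fock (Orb (FermionTorus 2 L))}
    (hψK : ψ ∈ szSector N 0) {E : ℝ} (hHψ : H *ᵥ ψ = (E : ℂ) • ψ) {lm lp u D K : ℝ}
    (hlm : lm ≤ H.minEnergyOn (szSector (N - 2) 0)) (hlp : lp ≤ H.minEnergyOn (szSector (N + 2) 0))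
    (hu : E ≤ u)
    (hD : (star ψ ⬝ᵥ (((pairField dWaveFormFactor L)ᴴ *
            (H * pairField dWaveFormFactor L - pairField dWaveFormFactor L * H) -
          (H * pairField dWaveFormFactor L - pairField dWaveFormFactor L * H) *
            (pairField dWaveFormFactor L)ᴴ) *ᵥ ψ)).re ≤ D)
    (hK : |(star ψ ⬝ᵥ ((pairField dWaveFormFactor L * (pairField dWaveFormFactor L)ᴴ) *ᵥ ψ)).re -
          (star ψ ⬝ᵥ (((pairField dWaveFormFactor L)ᴴ * pairField dWaveFormFactor L) *ᵥ ψ)).re| ≤ K) :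
    (lm + lp - 2 * u) *
        (star ψ ⬝ᵥ (((pairField dWaveFormFactor L)ᴴ * pairField dWaveFormFactor L) *ᵥ ψ)).re ≤
      D + |lp - u| * K := by
  set P := pairField dWaveFormFactor L with hP
  -- sector bookkeeping at momentum zero
  have h1 : P *ᵥ ψ ∈ szSector (N - 2) 0 := by
    have h := pairFieldAt_mulVec_mem_szSector dWaveFormFactor
      (0 : TorusSite 2 L) hN hψK
    rwa [pairFieldAt_zero] at h
  have h2 : Pᴴ *ᵥ ψ ∈ szSector (N + 2) 0 := by
    have h := conjTranspose_pairFieldAt_mulVec_mem_szSector dWaveFormFactor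
      (0 : TorusSite 2 L) hψK
    rwa [pairFieldAt_zero] at h
  -- Gram identities
  have hSm : star (P *ᵥ ψ) ⬝ᵥ (P *ᵥ ψ) = star ψ ⬝ᵥ ((Pᴴ * P) *ᵥ ψ) :=
    Literature.MathematicalPhysics.QuantumLattice.star_mulVec_dotProduct_mulVec P P ψ
  have hSp : star (Pᴴ *ᵥ ψ) ⬝ᵥ (Pᴴ *ᵥ ψ) = star ψ ⬝ᵥ ((P * Pᴴ) *ᵥ ψ) := by
    rw [Literature.MathematicalPhysics.QuantumLattice.star_mulVec_dotProduct_mulVec,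
      conjTranspose_conjTranspose]
  have hSm0 : 0 ≤ (star ψ ⬝ᵥ ((Pᴴ * P) *ᵥ ψ)).re := by
    rw [← hSm]; exact (Complex.nonneg_iff.1 (dotProduct_star_self_nonneg _)).1
  have hSp0 : 0 ≤ (star ψ ⬝ᵥ ((P * Pᴴ) *ᵥ ψ)).re := by
    rw [← hSp]; exact (Complex.nonneg_iff.1 (dotProduct_star_self_nonneg _)).1
  -- the variational principle in the two neighbouring sectors, homogeneous form
  have ham : H.minEnergyOn (szSector (N - 2) 0) * (star (P *ᵥ ψ) ⬝ᵥ (P *ᵥ ψ)).re ≤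
      (star (P *ᵥ ψ) ⬝ᵥ (H *ᵥ (P *ᵥ ψ))).re :=
    mul_norm_le_of_unit_bound_submodule H (szSector (N - 2) 0)
      (fun v hv hv1 => minEnergyOn_le_rayleigh_of_mem hH _ hv hv1) h1
  have hap : H.minEnergyOn (szSector (N + 2) 0) * (star (Pᴴ *ᵥ ψ) ⬝ᵥ (Pᴴ *ᵥ ψ)).re ≤
      (star (Pᴴ *ᵥ ψ) ⬝ᵥ (H *ᵥ (Pᴴ *ᵥ ψ))).re :=
    mul_norm_le_of_unit_bound_submodule H (szSector (N + 2) 0)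
      (fun v hv hv1 => minEnergyOn_le_rayleigh_of_mem hH _ hv hv1) h2
  rw [hSm] at ham
  rw [hSp] at hap
  have ham' : lm * (star ψ ⬝ᵥ ((Pᴴ * P) *ᵥ ψ)).re ≤ (star (P *ᵥ ψ) ⬝ᵥ (H *ᵥ (P *ᵥ ψ))).re :=
    (mul_le_mul_of_nonneg_right hlm hSm0).trans ham
  have hap' : lp * (star ψ ⬝ᵥ ((P * Pᴴ) *ᵥ ψ)).re ≤ (star (Pᴴ *ᵥ ψ) ⬝ᵥ (H *ᵥ (Pᴴ *ᵥ ψ))).re :=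
    (mul_le_mul_of_nonneg_right hlp hSp0).trans hap
  -- the own-bottom identity
  have hDC := mc_dotProduct_doubleComm_of_eigen hH hHψ P
  have hre := congrArg Complex.re hDC
  rw [Complex.add_re, Complex.sub_re, Complex.sub_re, Complex.re_ofReal_mul,
    Complex.re_ofReal_mul, hSm, hSp] at hre
  exact pairTower_real hre hD hu hSm0 hSp0 hK ham' hap'

/-- **The energy-only ceiling row** (what the inequality buys at finite `L`): under the hypotheses of
`pairTower_of_certified_inputs` for a NORMALISED `ψ`, if the certified pair charge gap
`g = l₋ + l₊ - 2u` is positive then `p_d(L; ψ) ≤ (D + |l₊ - u| K) / (g L⁴)`. Orders of magnitude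
(estimates, not certified): `D + |l₊ - u| K ≈ (30–60) · L²` at `U = 8`, so the ceiling is
`≈ (30–60)/(g L²)` — its decay in `L` is the content; at certifiable sides the binding input is a
certified `g > 0` (three sector energies to absolute width `≲ 0.1 t`).
[cite: TasakiWatanabe2021, Theorem (10)] -/
theorem pairFieldDensity_le_of_certified_inputs {L : ℕ} [NeZero L]
    {H : Matrix (Finset (Orb (FermionTorus 2 L))) (Finset (Orb (FermionTorus 2 L))) ℂ}
    (hH : H.IsHermitian) {N : ℕ} (hN : 2 ≤ N) {ψ : Fock (Orb (FermionTorus 2 L))}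
    (hψK : ψ ∈ szSector N 0) {E : ℝ} (hHψ : H *ᵥ ψ = (E : ℂ) • ψ) {lm lp u D K : ℝ}
    (hlm : lm ≤ H.minEnergyOn (szSector (N - 2) 0)) (hlp : lp ≤ H.minEnergyOn (szSector (N + 2) 0))
    (hu : E ≤ u) (hg : 0 < lm + lp - 2 * u)
    (hD : (star ψ ⬝ᵥ (((pairField dWaveFormFactor L)ᴴ *
            (H * pairField dWaveFormFactor L - pairField dWaveFormFactor L * H) -
          (H * pairField dWaveFormFactor L - pairField dWaveFormFactor L * H) *
            (pairField dWaveFormFactor L)ᴴ) *ᵥ ψ)).re ≤ D)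
    (hK : |(star ψ ⬝ᵥ ((pairField dWaveFormFactor L * (pairField dWaveFormFactor L)ᴴ) *ᵥ ψ)).re -
          (star ψ ⬝ᵥ (((pairField dWaveFormFactor L)ᴴ * pairField dWaveFormFactor L) *ᵥ ψ)).re| ≤ K) :
    pairFieldDensity L ψ ≤ (D + |lp - u| * K) / ((lm + lp - 2 * u) * (L : ℝ) ^ 4) := by
  have key := pairTower_of_certified_inputs hH hN hψK hHψ hlm hlp hu hD hK
  obtain ⟨L', rfl⟩ : ∃ L', L = L' + 1 := ⟨L - 1, (Nat.succ_pred_eq_of_pos (NeZero.pos L)).symm⟩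
  have hL0 : (0 : ℝ) < ((L' + 1 : ℕ) : ℝ) ^ 4 := by positivity
  have hS : pairFieldDensity (L' + 1) ψ =
      (star ψ ⬝ᵥ (((pairField dWaveFormFactor (L' + 1))ᴴ *
        pairField dWaveFormFactor (L' + 1)) *ᵥ ψ)).re / ((L' + 1 : ℕ) : ℝ) ^ 4 := rfl
  rw [hS, div_le_div_iff₀ hL0 (mul_pos hg hL0)]
  calc (star ψ ⬝ᵥ (((pairField dWaveFormFactor (L' + 1))ᴴ *
          pairField dWaveFormFactor (L' + 1)) *ᵥ ψ)).re * ((lm + lp - 2 * u) * ((L' + 1 : ℕ) : ℝ) ^ 4)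
      = ((lm + lp - 2 * u) * (star ψ ⬝ᵥ (((pairField dWaveFormFactor (L' + 1))ᴴ *
          pairField dWaveFormFactor (L' + 1)) *ᵥ ψ)).re) * ((L' + 1 : ℕ) : ℝ) ^ 4 := by ring
    _ ≤ (D + |lp - u| * K) * ((L' + 1 : ℕ) : ℝ) ^ 4 := mul_le_mul_of_nonneg_right key hL0.le

end Summit.HubbardSuperconductivity.HubbardLadder
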